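import Summits.BirchSwinnertonDyer.Rank1Residual.X2.TwistTamagawa
import Literature.NumberTheory.EllipticCurves.QuadraticTwistTamagawaI0starExactProofs
import Literature.NumberTheory.EllipticCurves.SerreOpenImageOrdinaryInertiaProofs
import HarnessLib

/-!
# Route `CMKolyvaginAtInertTwo`, crux `CMKolyvaginExactAtInertTwo` (stmt-BirchSwinnertonDyer-24277):
# THE COUNT IDENTITY `#Ш(E/K)[2^∞] = #Ш(E/ℚ)[2^∞] · #Ш(E^{(d_K)}/ℚ)[2^∞]`, IIIb —
# the `2`-adic Tamagawa product of the Heegner twist: `ord₂ ∏_ℓ c_ℓ(E^{(d_K)}) = ord₂ ∏_ℓ c_ℓ(E) +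
# ord₂ c_q(E^{(d_K)})` for a PRIME `|d_K| = q`, with `ord₂ c_q` read off `(Δ_E/q)` and the parity of
# `a_q(E)`

Seat `bsd-line-cmk2-p1` g15 (cell `bsd-print-cf2`); helper (`--supports stmt-BirchSwinnertonDyer-24277`).
THEOREMS ONLY: no definition, no named fact, no `sorry`; no item is closed; BSD is not proved by this.

The tree's `X2.padicValNat_tamagawaProduct_twist_of_heegner_of_odd` (cell `b2b-bsdres`) gives
`ord_p ∏c(E^{(d_K)}) = ord_p ∏c(E)` at ODD `p ∤ d_K`: prime by prime, `c_ℓ(E^{(d_K)}) = c_ℓ(E)` at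
`ℓ ∣ N` (split in `K`: `d_K ∈ (ℚ_ℓ^×)²`, `ℚ_ℓ`-isomorphic curves), both `1` at `ℓ ∤ N d_K`, and at a
ramified `ℓ ∣ d_K` the twist is of Kodaira type `I₀*` with `c_ℓ ∈ {1, 2, 4}` — a unit away from `2`.
At `p = 2` the ramified prime contributes EXACTLY `ord₂ c_q(E^{(d_K)}) = [(Δ/q) = −1] +
2·[(Δ/q) = 1 ∧ a_q even]` (tree `TwistIstar.padicValNat_two_localTamagawaNumber_twist_of_dvd`,
Kramer 1981 Prop. 3 / Boxer–Diao 2010 Prop. 4.1: `c_q = #Ẽ(𝔽_q)[2]`). On the habitat of the crux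
(`K = ℚ(√−q)` a Heegner field for a CM curve with `ℚ(√Δ_E) = F`), `q` is inert in `F`, `(Δ/q) = −1`
and the defect is exactly one factor `2` — the factor that cancels the regulator's `2` (file I).

* `padicValNat_localTamagawaNumber_twist_eq_of_not_dvd_discr` — `ord_p c_ℓ(Wd) = ord_p c_ℓ(W)`
  at every prime `ℓ ∤ d_K`, EVERY `p` (split `ℓ ∣ N`; good unramified `ℓ ∤ N`);
* `padicValNat_two_localTamagawaNumber_twist_eq_add_of_prime_discr` — at every prime `ℓ`, for prime
  `|d_K| = q`: `ord₂ c_ℓ(Wd) = ord₂ c_ℓ(W) + [ℓ = q]·([(Δ/q) = −1] + 2[(Δ/q) = 1 ∧ a_q even])`;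
* `padicValNat_two_tamagawaProduct_twist_of_heegner_of_prime_discr` — **the product identity**;
* `padicValNat_two_tamagawaProduct_twist_of_heegner_of_jacobiSym_eq_neg_one` —
  **`ord₂ ∏c(Wd) = ord₂ ∏c(W) + 1`** when `(Δ_E/q) = −1`.

References: Kramer 1981 Prop. 3; Boxer–Diao 2010 Prop. 4.1; Jetchev–Skinner–Wan 2017 §7.4.1;
Silverman *ATAEC* IV.9 Table 4.1.
-/

-- single-conjunct summit: `Summit.BirchSwinnertonDyer.BirchSwinnertonDyer.…` repeats the name by design
set_option linter.dupNamespace false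
set_option autoImplicit false

noncomputable section

open scoped Classical

open IsDedekindDomain NumberField Rat.HeightOneSpectrum WeierstrassCurve
  Literature.NumberTheory.EllipticCurves Literature.NumberTheory.QuadraticFields
  Literature.NumberTheory.EllipticCurves.Rank1Residual
  Summit.BirchSwinnertonDyer.Rank1Residual Summit.BirchSwinnertonDyer.Rank1Residual.X2

namespace Summit.BirchSwinnertonDyer.BirchSwinnertonDyer.Theorems.ShaCountTwo

/-! ## §1 Prime by prime -/

section Local

variable (W : WeierstrassCurve ℚ) [W.IsElliptic] [W.IsGloballyMinimal]
  (K : Type) [Field K] [NumberField K] (hK : IsImaginaryQuadratic K)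
  (hodd : Odd (NumberField.discr K)) (hH : SatisfiesHeegnerHypothesis (W.conductorNorm ℤ) K)
  {Wd : WeierstrassCurve ℚ} [Wd.IsElliptic] (Cd : VariableChange ℚ)
  (hWd : Cd • W.quadraticTwist (NumberField.discr K : ℚ) = Wd)

omit [W.IsGloballyMinimal] in
include hK hodd hH hWd in
/-- **`ord_p c_ℓ(E^{(d_K)}) = ord_p c_ℓ(E)` at every prime `ℓ ∤ d_K`, for EVERY prime `p`** (`K`
imaginary quadratic, `d_K` odd, Heegner hypothesis for the conductor of the globally minimal `W`,
`Wd = Cd • W^{(d_K)}` any equation of the twist): `ℓ ∣ N` — `d_K ∈ (ℚ_ℓ^×)²`, the curves are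
`ℚ_ℓ`-isomorphic (`X11b.isSquare_discr_padic_of_heegner`); `ℓ ∤ N d_K` — `d_K ≡ 1 (mod 4)`, the
twist is unramified at `ℓ` and both curves are good there, `c = 1`
(`X2.localTamagawaNumber_twist_of_not_dvd`). The odd-`p` version with the ramified primes included
is the tree's `X2.padicValNat_localTamagawaNumber_twist_eq_of_odd`.
[cite: JetchevSkinnerWan2017, §7.4.1 (eq:tamK)] [cite: SilvermanATAEC1994, Cor. IV.9.2(d)] -/
theorem padicValNat_localTamagawaNumber_twist_eq_of_not_dvd_discr (p : ℕ) (ℓ : ℕ) [Fact ℓ.Prime]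
    (hℓd : ¬ (ℓ : ℤ) ∣ NumberField.discr K) :
    padicValNat p ((Wd.baseChange ℚ_[ℓ]).localTamagawaNumber ℤ_[ℓ]) =
      padicValNat p ((W.baseChange ℚ_[ℓ]).localTamagawaNumber ℤ_[ℓ]) := by
  have hℓP : ℓ.Prime := Fact.out
  set d : ℤ := NumberField.discr K with hd_def
  have hdZ : d ≠ 0 := NumberField.discr_ne_zero K
  have hD0 : (d : ℚ) ≠ 0 := by exact_mod_cast hdZ
  haveI : (W.baseChange ℚ_[ℓ]).IsElliptic :=
    inferInstanceAs (W.map (algebraMap ℚ ℚ_[ℓ])).IsElliptic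
  haveI : (Wd.baseChange ℚ_[ℓ]).IsElliptic :=
    inferInstanceAs (Wd.map (algebraMap ℚ ℚ_[ℓ])).IsElliptic
  haveI : (W.quadraticTwist (d : ℚ)).IsElliptic := W.isElliptic_quadraticTwist hD0
  by_cases hℓN : ℓ ∣ W.conductorNorm ℤ
  · -- `ℓ ∣ N`: `d_K` is a square in `ℚ_ℓ`, the two curves are `ℚ_ℓ`-isomorphic
    obtain ⟨θ, hθ⟩ := X11b.isSquare_discr_padic_of_heegner K hK hH ℓ hℓN
    have hθ0 : θ ≠ 0 := by
      rintro rfl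
      exact (map_ne_zero (algebraMap ℚ ℚ_[ℓ])).mpr hD0 (hθ.trans (mul_zero 0))
    obtain ⟨C, hC⟩ := (W.baseChange ℚ_[ℓ]).exists_variableChange_smul_eq_quadraticTwist_sq hθ0
    have h1 : (W.quadraticTwist (d : ℚ)).baseChange ℚ_[ℓ] = C • W.baseChange ℚ_[ℓ] := by
      rw [hC, baseChange, baseChange, map_quadraticTwist, hθ, sq]
    have hYX : Wd.baseChange ℚ_[ℓ] = (Cd.map (algebraMap ℚ ℚ_[ℓ]) * C) • W.baseChange ℚ_[ℓ] := by
      rw [← hWd, WeierstrassCurve.VariableChange.baseChange_smul_eq (W.quadraticTwist (d : ℚ)) Cd ℚ_[ℓ],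
        h1, mul_smul]
    rw [hYX, localTamagawaNumber_variableChange_holds ℤ_[ℓ] (W.baseChange ℚ_[ℓ])
      (Cd.map (algebraMap ℚ ℚ_[ℓ]) * C)]
  · -- `ℓ ∤ N d_K`: both curves are good at `ℓ`
    have hgood : W.HasGoodReductionAtPrime ℓ := by
      by_contra h
      exact hℓN ((W.dvd_conductorNorm_iff_not_hasGoodReductionAtPrime ℓ).mpr h)
    have hcW : (W.baseChange ℚ_[ℓ]).localTamagawaNumber ℤ_[ℓ] = 1 := by
      haveI : ((W.baseChange ℚ_[ℓ]).minimal ℤ_[ℓ]).HasGoodReduction ℤ_[ℓ] := hgood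
      exact localTamagawaNumber_eq_one_of_hasGoodReduction_holds ℤ_[ℓ] _
    have h4 : d = 4 * (d / 4) + 1 := by
      rcases Quadratic.isFundamentalDiscriminant_discr (K := K) hK.1 with ⟨h1, -, -⟩ | ⟨h4, -, -⟩
      · omega
      · exfalso
        obtain ⟨k, hk⟩ := h4
        obtain ⟨m, hm⟩ := hodd
        omega
    rw [hcW, localTamagawaNumber_twist_of_not_dvd W ℓ h4 hℓd hgood Cd hWd]

include hK hodd hH hWd in
/-- **`ord₂ c_ℓ(E^{(d_K)})` at every prime `ℓ` when `|d_K| = q` is PRIME:**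
`ord₂ c_ℓ(Wd) = ord₂ c_ℓ(W) + [ℓ = q]·([(Δ/q) = −1] + 2·[(Δ/q) = 1 ∧ a_q even])`. Off `q` this is
`padicValNat_localTamagawaNumber_twist_eq_of_not_dvd_discr`; at `q` (`q ∤ N` since `q` ramifies,
so `W` is good at `q`, `c_q(W) = 1`, `q ∤ Δ_min`; `q` odd; `q ∥ d_K`) the twist is of type `I₀*`
with `c_q = #Ẽ(𝔽_q)[2]`, whose `2`-adic valuation is the tree's dictionary
`TwistIstar.padicValNat_two_localTamagawaNumber_twist_of_dvd` (Kramer 1981 Prop. 3; Boxer–Diao 2010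
Prop. 4.1). Here `Δ = W.Δ.num` is the minimal discriminant. [cite: Kramer1981, Prop. 3]
[cite: BoxerDiao2010, proof of Prop. 4.1 (p. 1977)] -/
theorem padicValNat_two_localTamagawaNumber_twist_eq_add_of_prime_discr
    (hq : (NumberField.discr K).natAbs.Prime) (ℓ : ℕ) [Fact ℓ.Prime] :
    padicValNat 2 ((Wd.baseChange ℚ_[ℓ]).localTamagawaNumber ℤ_[ℓ]) =
      padicValNat 2 ((W.baseChange ℚ_[ℓ]).localTamagawaNumber ℤ_[ℓ]) +
        (if ℓ = (NumberField.discr K).natAbs then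
          ((if jacobiSym W.Δ.num (NumberField.discr K).natAbs = -1 then 1 else 0) +
            (if jacobiSym W.Δ.num (NumberField.discr K).natAbs = 1 ∧
              Even (W.frobeniusTrace (NumberField.discr K).natAbs) then 2 else 0))
        else 0) := by
  have hℓP : ℓ.Prime := Fact.out
  set d : ℤ := NumberField.discr K with hd_def
  set q : ℕ := d.natAbs with hq_def
  have hdZ : d ≠ 0 := NumberField.discr_ne_zero K
  by_cases hℓq : ℓ = q
  · -- the ramified prime
    subst hℓq
    rw [if_pos rfl]
    have hqd : (q : ℤ) ∣ d := by rw [hq_def]; exact Int.natAbs_dvd.mpr (dvd_refl d)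
    have hq2 : q ≠ 2 := by
      intro h
      obtain ⟨m, hm⟩ := hodd
      have h2 : (2 : ℤ) ∣ d := by
        have := hqd
        rw [h] at this
        exact_mod_cast this
      omega
    have hsq : ¬ ((q : ℤ)) ^ 2 ∣ d := by
      intro h
      have hsf := squarefree_discr_of_odd hK hodd
      have hunit := hsf (q : ℤ) (by rw [← sq]; exact h)
      rw [Int.isUnit_iff_natAbs_eq, Int.natAbs_natCast] at hunit
      exact hq.one_lt.ne' hunit
    -- `q` does not split (it ramifies: `q ∣ d_K`), hence `q ∤ N` and `W` is good at `q`
    have hqN : ¬ q ∣ W.conductorNorm ℤ := by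
      intro hqN
      refine not_dvd_discr_of_split hK hq hq2 (fun p hp hpq => ?_) hqd
      rw [(Nat.prime_dvd_prime_iff_eq hp hq).mp hpq]
      exact hH q hq hqN
    have hgood : W.HasGoodReductionAtPrime q := by
      by_contra h
      exact hqN ((W.dvd_conductorNorm_iff_not_hasGoodReductionAtPrime q).mpr h)
    haveI : (W.baseChange ℚ_[q]).IsElliptic :=
      inferInstanceAs (W.map (algebraMap ℚ ℚ_[q])).IsElliptic
    have hcW : (W.baseChange ℚ_[q]).localTamagawaNumber ℤ_[q] = 1 := by
      haveI : ((W.baseChange ℚ_[q]).minimal ℤ_[q]).HasGoodReduction ℤ_[q] := hgood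
      exact localTamagawaNumber_eq_one_of_hasGoodReduction_holds ℤ_[q] _
    have hqΔ : ¬ (q : ℤ) ∣ minimalDiscriminantInt W :=
      not_dvd_minimalDiscriminantInt_of_hasGoodReductionAtPrime' W q hgood
    rw [hcW, padicValNat_one_right, zero_add]
    exact TwistIstar.padicValNat_two_localTamagawaNumber_twist_of_dvd W q hq2 hqΔ hqd hsq Cd hWd
  · rw [if_neg hℓq, add_zero]
    have hℓd : ¬ (ℓ : ℤ) ∣ d := by
      intro h
      have h' : ℓ ∣ q := by rw [hq_def]; exact Int.natCast_dvd_natCast.mp (Int.dvd_natAbs.mpr h)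
      rcases (Nat.dvd_prime hq).mp h' with h1 | h1
      · exact hℓP.one_lt.ne' h1
      · exact hℓq h1
    exact padicValNat_localTamagawaNumber_twist_eq_of_not_dvd_discr W K hK hodd hH Cd hWd 2 ℓ hℓd

end Local

/-! ## §2 The product -/

/-- `ord_p` of a finite product of non-zero naturals is the sum of the `ord_p`. [folklore] -/
private theorem padicValNat_finset_prod'' (p : ℕ) [Fact p.Prime] {ι : Type*} (s : Finset ι)
    (f : ι → ℕ) (hf : ∀ i ∈ s, f i ≠ 0) :
    padicValNat p (∏ i ∈ s, f i) = ∑ i ∈ s, padicValNat p (f i) := by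
  induction s using Finset.induction_on with
  | empty => simp
  | insert a s ha ih =>
    rw [Finset.prod_insert ha, Finset.sum_insert ha,
      padicValNat.mul (hf a (Finset.mem_insert_self a s))
        (Finset.prod_ne_zero_iff.mpr fun i hi => hf i (Finset.mem_insert_of_mem hi)),
      ih fun i hi => hf i (Finset.mem_insert_of_mem hi)]

section Product

variable (W : WeierstrassCurve ℚ) [W.IsElliptic] [W.IsGloballyMinimal]
  (K : Type) [Field K] [NumberField K] (hK : IsImaginaryQuadratic K)
  (hodd : Odd (NumberField.discr K)) (hH : SatisfiesHeegnerHypothesis (W.conductorNorm ℤ) K)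
  {Wd : WeierstrassCurve ℚ} [Wd.IsElliptic] (Cd : VariableChange ℚ)
  (hWd : Cd • W.quadraticTwist (NumberField.discr K : ℚ) = Wd)

include hK hodd hH hWd in
/-- **`ord₂ ∏_ℓ c_ℓ(E^{(d_K)}) = ord₂ ∏_ℓ c_ℓ(E) + [(Δ/q) = −1] + 2·[(Δ/q) = 1 ∧ a_q(E) even]`** for a
Heegner field `K = ℚ(√d_K)` of the globally minimal `W` with `|d_K| = q` PRIME (odd), and any
equation `Wd = Cd • W^{(d_K)}` of the twist: both Tamagawa products are finite products over the bad
places and `q` (`tamagawaProduct_eq_prod`), compared prime by prime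
(`padicValNat_two_localTamagawaNumber_twist_eq_add_of_prime_discr`).
[cite: Kramer1981, Prop. 3] [cite: JetchevSkinnerWan2017, §7.4.1 (eq:tamK) (pp. 29–31)] -/
theorem padicValNat_two_tamagawaProduct_twist_of_heegner_of_prime_discr
    (hq : (NumberField.discr K).natAbs.Prime) :
    padicValNat 2 Wd.tamagawaProduct = padicValNat 2 W.tamagawaProduct +
      ((if jacobiSym W.Δ.num (NumberField.discr K).natAbs = -1 then 1 else 0) +
        (if jacobiSym W.Δ.num (NumberField.discr K).natAbs = 1 ∧
          Even (W.frobeniusTrace (NumberField.discr K).natAbs) then 2 else 0)) := by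
  haveI : Fact (Nat.Prime 2) := ⟨Nat.prime_two⟩
  set q : ℕ := (NumberField.discr K).natAbs with hq_def
  have hfW : (W.badPlaces ℤ).Finite := W.finite_badPlaces_holds ℤ
  have hfWd : (Wd.badPlaces ℤ).Finite := Wd.finite_badPlaces_holds ℤ
  -- the place of `ℤ` over `q`
  set vq : IsDedekindDomain.HeightOneSpectrum ℤ := primesEquiv.symm ⟨q, hq⟩ with hvq_def
  have hvq : (primesEquiv vq : ℕ) = q := by rw [hvq_def, Equiv.apply_symm_apply]
  set s : Finset (IsDedekindDomain.HeightOneSpectrum ℤ) :=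
    hfW.toFinset ∪ hfWd.toFinset ∪ {vq} with hs
  have hsW : ∀ v, ¬ W.HasGoodReductionAt v → v ∈ s := fun v hv ↦
    Finset.mem_union_left _ (Finset.mem_union_left _
      (by rw [Set.Finite.mem_toFinset, mem_badPlaces_iff]; exact hv))
  have hsWd : ∀ v, ¬ Wd.HasGoodReductionAt v → v ∈ s := fun v hv ↦
    Finset.mem_union_left _ (Finset.mem_union_right _
      (by rw [Set.Finite.mem_toFinset, mem_badPlaces_iff]; exact hv))
  have hvqs : vq ∈ s := Finset.mem_union_right _ (Finset.mem_singleton_self _)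
  rw [tamagawaProduct_eq_prod W s hsW, tamagawaProduct_eq_prod Wd s hsWd,
    padicValNat_finset_prod'' 2 s _ fun v _ ↦ ?_, padicValNat_finset_prod'' 2 s _ fun v _ ↦ ?_]
  · -- termwise
    have hterm : ∀ v ∈ s,
        padicValNat 2 (haveI := Fact.mk (primesEquiv v).2
          (Wd.baseChange ℚ_[primesEquiv v]).localTamagawaNumber ℤ_[primesEquiv v]) =
        padicValNat 2 (haveI := Fact.mk (primesEquiv v).2
          (W.baseChange ℚ_[primesEquiv v]).localTamagawaNumber ℤ_[primesEquiv v]) +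
          (if v = vq then
            ((if jacobiSym W.Δ.num q = -1 then 1 else 0) +
              (if jacobiSym W.Δ.num q = 1 ∧ Even (W.frobeniusTrace q) then 2 else 0))
          else 0) := by
      intro v _
      haveI := Fact.mk (primesEquiv v).2
      have h := padicValNat_two_localTamagawaNumber_twist_eq_add_of_prime_discr W K hK hodd hH Cd hWd
        hq (primesEquiv v)
      have hiff : ((primesEquiv v : ℕ) = q) ↔ v = vq := by
        constructor
        · intro h1
          apply primesEquiv.injective
          rw [hvq_def, Equiv.apply_symm_apply]
          exact Subtype.ext h1
        · intro h1
          rw [h1, hvq]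
      rw [h]
      by_cases hv : v = vq
      · rw [if_pos (hiff.mpr hv), if_pos hv]
      · rw [if_neg (fun h1 => hv (hiff.mp h1)), if_neg hv]
    rw [Finset.sum_congr rfl hterm, Finset.sum_add_distrib, Finset.sum_ite_eq' s vq, if_pos hvqs]
  · haveI := Fact.mk (primesEquiv v).2
    haveI : (Wd.baseChange ℚ_[primesEquiv v]).IsElliptic :=
      inferInstanceAs (Wd.map (algebraMap ℚ ℚ_[primesEquiv v])).IsElliptic
    exact localTamagawaNumber_padic_ne_zero_holds (primesEquiv v) _
  · haveI := Fact.mk (primesEquiv v).2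
    haveI : (W.baseChange ℚ_[primesEquiv v]).IsElliptic :=
      inferInstanceAs (W.map (algebraMap ℚ ℚ_[primesEquiv v])).IsElliptic
    exact localTamagawaNumber_padic_ne_zero_holds (primesEquiv v) _

include hK hodd hH hWd in
/-- **`ord₂ ∏_ℓ c_ℓ(E^{(d_K)}) = ord₂ ∏_ℓ c_ℓ(E) + 1` on a prime Heegner field `ℚ(√−q)` at which
Frobenius at `q` acts on `E[2]` as a transposition** (`(Δ_E/q) = −1`: exactly one `𝔽_q`-root of the
`2`-division cubic, `c_q(E^{(d_K)}) = #Ẽ(𝔽_q)[2] = 2`). On the habitat of the crux this is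
automatic: `ℚ(√Δ_E) = F` (CM field, `ρ̄_{E,2}` onto) and `q` is inert in `F`. [cite: Kramer1981, Prop. 3]
[cite: BoxerDiao2010, proof of Prop. 4.1 (p. 1977)] -/
theorem padicValNat_two_tamagawaProduct_twist_of_heegner_of_jacobiSym_eq_neg_one
    (hq : (NumberField.discr K).natAbs.Prime)
    (hjac : jacobiSym W.Δ.num (NumberField.discr K).natAbs = -1) :
    padicValNat 2 Wd.tamagawaProduct = padicValNat 2 W.tamagawaProduct + 1 := by
  rw [padicValNat_two_tamagawaProduct_twist_of_heegner_of_prime_discr W K hK hodd hH Cd hWd hq,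
    if_pos hjac, if_neg (by rw [hjac]; simp), add_zero]

end Product

end Summit.BirchSwinnertonDyer.BirchSwinnertonDyer.Theorems.ShaCountTwo

end
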